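import Mathlib
import Literature.NumberTheory.LFunctions.Zhang2022.Section14Prop141Twisted
import Literature.NumberTheory.LFunctions.Zhang2022.Section14Eq143Twisted
import Literature.NumberTheory.LFunctions.Zhang2022.Section14U017Twisted
import Literature.NumberTheory.LFunctions.Zhang2022.Section14U004Termwise
import Literature.NumberTheory.LFunctions.Zhang2022.Section14Regrouping
import Literature.NumberTheory.LFunctions.Zhang2022.Section14Majorant1413
import Literature.NumberTheory.LFunctions.Zhang2022.TypedSection14Proofs
import HarnessLib

/-!
# Zhang (2022) §14: Proposition 14.1 (GENERAL `β`) reduced to the three window estimates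
# (14.8) leg 1, (14.8) leg 2 and (14.6), each with the twist `(pt₀)^β`

Topic `Literature/NumberTheory/LFunctions/Zhang2022` (Landau–Siegel audit tree; verdict-neutral;
leaf `Skeleton.Prop141` of the ZHANG-L discharge lane, rows G-L3t7-1 / G-adj2-4).
Y. Zhang, *Discrete mean estimates and the Landau–Siegel zero*, arXiv:2211.02515v1 (2022)
[Zhang2022LandauSiegel] — **an unrefereed manuscript under adjudication**; this file PROVES one
implication; it asserts none of its hypotheses and says nothing about Theorems 1–2 of the manuscript
or about Landau–Siegel zeros.

`prop141_of_legs`: the banked leaf `Skeleton.Prop141` (Proposition 14.1 for every `|β| < 5α`) follows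
from exactly three estimates, stated inline with the weight `(pt₀)^β` (`Typed.Sec14.wt`) inside the
`p`-sum — the two `r`-ranges of (14.8) in the u017 shape `Typed.Sec14.rhs1417OnW` on the CLOSED range
`r ≤ 2DP₄` ("for `1 < r < D³` … Lemma 5.6; for `D³ ≤ r < 2DP₄` … the large sieve inequality", §14 p.79,
tex L3960–L3963) and (14.6) with the twist ("The proof of (14.6) is analogous", tex L3966). Everything
else of §14 is a tree theorem and is composed here: (14.3)ᵂ `Eq143.eq143W`, u004→u010
`step14u010_holds`, (14.7) `eq147_holds`, u013 `step14u013a_holds`/`step14u013b_holds`, u015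
`step14u015_holds`, u017ᵂ `eq148W_of_legs_closed` (zl-w14-p2), and the two general-`β` deduction
edges `eq145W_of_parts`, `prop141_of_parts` (`Section14Prop141Twisted`).

## References

* Y. Zhang, arXiv:2211.02515v1 (2022), §14 pp. 76–79, Prop. 14.1, (14.3)–(14.8).
  [cite: Zhang2022LandauSiegel, §14 Prop. 14.1 (proof) pp.76–79, tex L3836–L3969]
-/

noncomputable section

open Complex Real

namespace Literature.NumberTheory.LFunctions.Zhang2022.Typed.Sec14

open Skeleton

/-- **Proposition 14.1 at general `β` from the three twisted window estimates** — W-leg1 (the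
`1 < r < D³` range of (14.8)), W-leg2 (the `D³ ≤ r ≤ 2DP₄` range) and W-146 ((14.6) with the twist),
all in the shapes of record (`rhs1417OnW`, `wt`; strike/zl-closer-5/WANTED.md). Composition:
`prop141_of_parts (14.3)ᵂ u010 (eq145W_of_parts (14.7) u013a u013b u015 (eq148W_of_legs_closed leg1 leg2)) (14.6)ᵂ`.
[cite: Zhang2022LandauSiegel, §14 Prop. 14.1 (proof) pp.76–79, tex L3836–L3969] -/
theorem prop141_of_legs
    (hleg1 : ∀ B : ℝ, ∃ c : ℝ, 0 < c ∧ ∃ C : ℝ, ForAllLarge fun D _ χ => AssumptionA D χ →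
      ∀ β : ℂ, ‖β‖ < 5 * alpha D → ∀ κs as : ℕ → ℂ, Eq141 B κs → Eq142 D B as →
        rhs1417OnW χ β κs ((Finset.Icc 2 ⌊2 * (D : ℝ) * P4 D⌋₊).filter (fun r => r < D ^ 3))
          ≤ C * bigP D ^ 2 * (D : ℝ) ^ (-c))
    (hleg2 : ∀ B : ℝ, ∃ c : ℝ, 0 < c ∧ ∃ C : ℝ, ForAllLarge fun D _ χ => AssumptionA D χ →
      ∀ β : ℂ, ‖β‖ < 5 * alpha D → ∀ κs as : ℕ → ℂ, Eq141 B κs → Eq142 D B as →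
        rhs1417OnW χ β κs ((Finset.Icc 2 ⌊2 * (D : ℝ) * P4 D⌋₊).filter (fun r => ¬ r < D ^ 3))
          ≤ C * bigP D ^ 2 * (D : ℝ) ^ (-c))
    (h146 : ∀ B : ℝ, ∃ c : ℝ, 0 < c ∧ ∃ C : ℝ, ForAllLarge fun D _ χ => AssumptionA D χ →
      ∀ β : ℂ, ‖β‖ < 5 * alpha D → ∀ κs as : ℕ → ℂ, Eq141 B κs → Eq142 D B as →
        ∀ D₁ D₂ : ℕ, D₁ * D₂ = D → 1 < D₁ →
          ‖∑ p ∈ primeWindow D, χ (p : ZMod D) * wt D β p * calS D D₁ D₂ p κs as‖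
            ≤ C * bigP D ^ 2 * (D : ℝ) ^ (1 / 2 - c)) :
    Prop141 :=
  prop141_of_parts (fun B ε hε => by simpa only [wt] using Eq143.eq143W B ε hε) step14u010_holds
    (eq145W_of_parts eq147_holds step14u013a_holds step14u013b_holds step14u015_holds
      (eq148W_of_legs_closed hleg1 hleg2)) h146

end Literature.NumberTheory.LFunctions.Zhang2022.Typed.Sec14
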